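import Mathlib.Topology.Algebra.Category.ProfiniteGrp.Completion
import Literature.AnabelianGeometry.AbsoluteAnabelian.AbsAnabUnitsTransportLevelwise
import Literature.AnabelianGeometry.AbsoluteAnabelian.AbsAnabLevelReciprocityProofs
import Literature.AnabelianGeometry.AbsoluteAnabelian.GaloisCyclotomeLevelReciprocity
import Literature.AnabelianGeometry.AbsoluteAnabelian.LocalReciprocityCofinal
import Literature.AnabelianGeometry.AbsoluteAnabelian.MLFUnitsOfGaloisGroupProofs
import Literature.AnabelianGeometry.AbsoluteAnabelian.GaloisCyclotomeFunctoriality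
import Literature.NumberTheory.GaloisRepresentations.RestrictFieldSelf
import HarnessLib

/-!
# [AbsTopIII] Cor. 1.10 (i)(b), NATURAL form — the reciprocity square
# `Art_{k₂} ∘ ψ̄_α = α^{ab} ∘ Art_{k₁}` on `k₁ˣ` and on the profinite completions `(kᵢˣ)^∧`

Mochizuki, *Topics in Absolute Anabelian Geometry III*, Cor. 1.10 (i)(b) p. 42 (manuscript
pagination, lit key `paper:url-5493eb38cbb7`): «a functorial "group-theoretic" algorithm for
reconstructing … `H¹(G_k, μ_Ẑ(G_k)) ⥲ G_k^ab`»; S. Mochizuki, *The Absolute Anabelian Geometry of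
Hyperbolic Curves* (2004) [AbsAnab], §1.2 p. 9 «`(K^×)^∧ ⥲ G^{ab}_K`», Prop. 1.2.1 (iii) p. 10 «`α^{ab}`
preserves `Im(K^×_i)`», proof p. 11 «by considering the Verlagerung».

This is the RECIPROCITY LEG of the naturality closer of `AbsTopIII.Cor_1_10_i_b_natural`
(abc-iut-L4-d1, `ReconstructionCor110iiPrime.lean`, reading (N)); abc-iut cell, layer L4, row
«Cor110ib-NAT» (abc-iut-L4-d3, L4-lead RULING #5r (4)).  For non-archimedean local fields `k₁, k₂` of
characteristic `0` (the tree's valued form, universe `0`), an isomorphism of topological groups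
`α : G_{k₁} ≃ₜ* G_{k₂}` and THE units transport `ψ̄ : k̄₁ˣ ⥲ k̄₂ˣ` of [AbsAnab] Prop. 1.2.1 (vi)
(`α`-equivariant, uniformiser-preserving; `Prop121vii.unitsTransport_holds`, unique by
`unitsTransport_unique`):

* `exists_completionEquiv_comp_eta_eq` — for EVERY reciprocity map `θ : kˣ → G_k^ab` in the tree's
  sense `IsLocalReciprocityMap` there is a topological isomorphism `e : (kˣ)^∧ ≃ₜ* G_k^ab` with
  `e ∘ η = θ` (the argument of abc-iut-L4-d1's `mlf_reciprocity_completion_holds`,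
  `LocalReciprocityCompletionProofs.lean`, re-run KEEPING the identity `e ∘ η = θ`, which that named fact
  forgets);
* `absGaloisAbProj_liftGal_self` — at the trivial level `E = k` the tree's lift
  `liftGal k k : Gal(k̄/k₀) → Γ_k` is an inner automorphism, so it is the identity on `G_k^ab`;
* `canonicalTheta_unitsTransport` — with `θ_k := θ` of the tree's canonical reciprocity system
  (`(isReciprocitySystemE (isClassFieldTheory_localWeilDatum k)).theta`, Serre's `x ↦ (x, */k)` read in
  Neukirch's Weil datum of `k`): `θ_{k₂} (ψ̄♭ u) = α^{ab} (θ_{k₁} u)` for every `u ∈ k₁ˣ`, `ψ̄♭` the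
  restriction of `ψ̄` to `k₁ˣ = (k̄₁ˣ)^{G_{k₁}}` — from abc-iut-L4-d3's
  `Prop121vii.levelwise_of_isAlphaEquivariant` (the level `(k₁, k₂)` of the Verlagerung tower) and
  `levelArt_eq_mk_iff_theta`;
* `completionEquiv_unitsTransport` — the same square on the profinite completions,
  `e_{k₂} (ψ̂ x) = α^{ab} (e_{k₁} x)` for all `x ∈ (k₁ˣ)^∧`, by density of `η(k₁ˣ)`.

Proof-only (theorems; no definitions, no named facts, no `sorry`).  HONEST FRAMING: classical local
class field theory (Serre, *Local Fields* XIII–XIV; Neukirch IV–V); [AbsTopIII]/[AbsAnab] are refereed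
papers; nothing here bears on [IUTchIII] Cor. 3.12 or takes a side; typed ≠ proved.
-/

noncomputable section

open CategoryTheory Topology Filter
open Field IsNonarchimedeanLocalField ValuativeRel
open scoped Pointwise

namespace Literature.AnabelianGeometry.AbsoluteAnabelian

open Literature.NumberTheory.GaloisRepresentations
open Literature.NumberTheory.GaloisRepresentations.LocalWeilDatum
open AbstractCFT AbstractCFT.WeilDatum

namespace Cor110Nat

universe u

/-! ### The completed reciprocity isomorphism through a GIVEN reciprocity map -/

section Completion

variable (K : Type u) [Field K] [ValuativeRel K] [TopologicalSpace K] [IsNonarchimedeanLocalField K]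
  [CharZero K]

/-- **`(Kˣ)^∧ ≃ₜ* G_K^ab` extending a given reciprocity map.**  For every homomorphism
`θ : Kˣ → G_K^ab` with the printed properties of Serre's reciprocity map (`IsLocalReciprocityMap`:
injective, image the Weil image, units homeomorphically onto the inertia image, uniformisers to
Frobenius) its continuous extension `e` to the profinite completion of `Kˣ` (Mathlib
`ProfiniteGrp.ProfiniteCompletion.lift`) is a topological isomorphism onto `G_K^ab` with `e ∘ η = θ`
([AbsAnab] §1.2 p. 9 «by local class field theory we have a natural isomorphism `(K^×)^∧ ⥲ G^{ab}_K`»).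
The argument is abc-iut-L4-d1's (`mlf_reciprocity_completion_holds`): surjective by density of the Weil
image, injective because every finite quotient `Kˣ/N` factors through `G_K^ab` modulo an open subgroup
(`exists_isOpen_comap_le`), homeomorphism since compact-to-Hausdorff; recorded here with the identity
`e ∘ η = θ` kept in the conclusion. [cite: MochizukiAbsAnab2004, §1.2 p.9] -/
theorem exists_completionEquiv_comp_eta_eq {θ : Kˣ →* absoluteGaloisGroupAbelianization K}
    (hθ : IsLocalReciprocityMap K θ) :
    ∃ e : ProfiniteGrp.ProfiniteCompletion.completion (GrpCat.of Kˣ) ≃ₜ*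
        absoluteGaloisGroupAbelianization K,
      (e.toMulEquiv.toMonoidHom).comp (ProfiniteGrp.ProfiniteCompletion.eta (GrpCat.of Kˣ)).hom = θ := by
  -- adapted from abc-iut-L4-d1, `LocalReciprocityCompletionProofs.lean` (`mlf_reciprocity_completion_holds`)
  classical
  haveI htd := totallyDisconnectedSpace_absoluteGaloisGroupAbelianization K
  haveI ht2 : T2Space (absoluteGaloisGroupAbelianization K) := by
    haveI : IsClosed ((commutator (absoluteGaloisGroup K)).topologicalClosure :
        Set (absoluteGaloisGroup K)) := Subgroup.isClosed_topologicalClosure _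
    infer_instance
  let P : ProfiniteGrp.{u} := ProfiniteGrp.of (absoluteGaloisGroupAbelianization K)
  let G : GrpCat.{u} := GrpCat.of Kˣ
  let f : G ⟶ GrpCat.of P := GrpCat.ofHom θ
  let ê := ProfiniteGrp.ProfiniteCompletion.lift f
  -- `ê ∘ η = θ`
  have hê_eta : ∀ x : Kˣ, ê.hom (ProfiniteGrp.ProfiniteCompletion.etaFn G x) = θ x := by
    intro x
    have h := ConcreteCategory.congr_hom (ProfiniteGrp.ProfiniteCompletion.lift_eta f) x
    simp only [GrpCat.comp_apply] at h
    exact h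
  have hcont : Continuous ê.hom := ê.hom.continuous_toFun
  -- SURJECTIVITY: dense compact image
  have hsurj : Function.Surjective ê.hom := by
    have hclosed : IsClosed (Set.range ê.hom) := (isCompact_range hcont).isClosed
    have hd : DenseRange (fun w : WeilGroup K => absGaloisAbProj K (WeilGroup.toAbsGalois K w)) :=
      DenseRange.comp QuotientGroup.mk_surjective.denseRange
        (WeilGroup.denseRange_toAbsGalois_holds K) QuotientGroup.continuous_mk
    have hsub : Set.range (fun w : WeilGroup K => absGaloisAbProj K (WeilGroup.toAbsGalois K w))
        ⊆ Set.range ê.hom := by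
      rintro _ ⟨w, rfl⟩
      have hmem : absGaloisAbProj K (WeilGroup.toAbsGalois K w) ∈ θ.range := by
        rw [hθ.range_eq]
        exact ⟨WeilGroup.toAbsGalois K w, by rw [← WeilGroup.range_toAbsGalois]; exact ⟨w, rfl⟩,
          rfl⟩
      obtain ⟨x, hx⟩ := hmem
      exact ⟨ProfiniteGrp.ProfiniteCompletion.etaFn G x, by rw [hê_eta, hx]⟩
    have hdense : Dense (Set.range ê.hom) := hd.mono hsub
    exact Set.range_eq_univ.mp (by rw [← hclosed.closure_eq, hdense.closure_eq])
  -- INJECTIVITY: the finite quotients of `Kˣ` factor through `G_K^{ab}`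
  have hinj : Function.Injective ê.hom := by
    rw [injective_iff_map_eq_one]
    intro x hx
    apply Subtype.ext
    funext N
    obtain ⟨V, hVopen, hVle⟩ := exists_isOpen_comap_le hθ N.toSubgroup
    let Vn : OpenNormalSubgroup P := { toSubgroup := V, isOpen' := hVopen }
    let N' : FiniteIndexNormalSubgroup G := ProfiniteGrp.ProfiniteCompletion.preimage f Vn
    have hle : N' ≤ N := fun y hy => hVle hy
    -- the injection `Kˣ / θ⁻¹(V) → G^{ab} / V`
    let j : (ProfiniteGrp.ProfiniteCompletion.diagram G).obj N' →*
        (absoluteGaloisGroupAbelianization K ⧸ V) :=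
      QuotientGroup.map N'.toSubgroup V θ le_rfl
    have hjinj : Function.Injective j := by
      rw [injective_iff_map_eq_one]
      intro y hy
      obtain ⟨g, rfl⟩ := QuotientGroup.mk_surjective y
      have h1 : (QuotientGroup.mk (θ g) : absoluteGaloisGroupAbelianization K ⧸ V) = 1 := hy
      rw [QuotientGroup.eq_one_iff] at h1
      exact (QuotientGroup.eq_one_iff g).mpr h1
    haveI : IsClosed ((V : Subgroup (absoluteGaloisGroupAbelianization K)) :
        Set (absoluteGaloisGroupAbelianization K)) := Subgroup.isClosed_of_isOpen V hVopen
    haveI : DiscreteTopology ((ProfiniteGrp.ProfiniteCompletion.diagram G).obj N') := ⟨rfl⟩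
    have key : (fun c : ProfiniteGrp.ProfiniteCompletion.completion G => j (c.1 N')) =
        fun c => (QuotientGroup.mk (ê.hom c) : absoluteGaloisGroupAbelianization K ⧸ V) := by
      refine (ProfiniteGrp.ProfiniteCompletion.denseRange G).equalizer ?_ ?_ ?_
      · have hproj : Continuous (fun c : ProfiniteGrp.ProfiniteCompletion.completion G =>
            (c.1 N' : (ProfiniteGrp.ProfiniteCompletion.diagram G).obj N')) :=
          ((ProfiniteGrp.limitCone (ProfiniteGrp.ProfiniteCompletion.diagram G)).π.app N').hom.continuous_toFun
        exact continuous_of_discreteTopology.comp hproj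
      · exact QuotientGroup.continuous_mk.comp hcont
      · funext g
        change j (QuotientGroup.mk g) = QuotientGroup.mk (ê.hom (ProfiniteGrp.ProfiniteCompletion.etaFn G g))
        rw [hê_eta]
        rfl
    have hN' : x.1 N' = 1 := by
      have h1 := congrFun key x
      simp only [hx, QuotientGroup.mk_one] at h1
      exact hjinj (h1.trans (map_one j).symm)
    have hcompat := x.2 (homOfLE hle)
    rw [← hcompat, hN', map_one]
    rfl
  -- the topological isomorphism
  let eEquiv : ProfiniteGrp.ProfiniteCompletion.completion G ≃ absoluteGaloisGroupAbelianization K :=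
    Equiv.ofBijective ê.hom ⟨hinj, hsurj⟩
  have hsymm : Continuous eEquiv.symm := (hcont.homeoOfEquivCompactToT2 (f := eEquiv)).symm.continuous
  let e : ProfiniteGrp.ProfiniteCompletion.completion G ≃ₜ* absoluteGaloisGroupAbelianization K :=
    { MulEquiv.ofBijective ê.hom.toMonoidHom ⟨hinj, hsurj⟩ with
      continuous_toFun := hcont
      continuous_invFun := hsymm }
  exact ⟨e, MonoidHom.ext fun x => hê_eta x⟩

/-- Pointwise form of `exists_completionEquiv_comp_eta_eq`: `e (η x) = θ x`.
[cite: MochizukiAbsAnab2004, §1.2 p.9] -/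
theorem exists_completionEquiv_apply_eta_eq {θ : Kˣ →* absoluteGaloisGroupAbelianization K}
    (hθ : IsLocalReciprocityMap K θ) :
    ∃ e : ProfiniteGrp.ProfiniteCompletion.completion (GrpCat.of Kˣ) ≃ₜ*
        absoluteGaloisGroupAbelianization K,
      ∀ x : Kˣ, e ((ProfiniteGrp.ProfiniteCompletion.eta (GrpCat.of Kˣ)).hom x) = θ x := by
  obtain ⟨e, he⟩ := exists_completionEquiv_comp_eta_eq K hθ
  exact ⟨e, fun x => DFunLike.congr_fun he x⟩

end Completion

/-! ### The trivial level `E = k`: `liftGal k k` is inner, `galFixing k (embField k k) = ⊤` -/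

section SelfLevel

variable (K : Type) [Field K]

/-- Every `γ ∈ Γ_K` fixes `K₀ = ι⁻¹(K) ⊆ K̄` (the image of `K`): `galFixing K (embField K K) = ⊤`.
[cite: MochizukiAbsAnab2004, §1.2 p.9] -/
theorem mem_galFixing_embField_self (γ : absoluteGaloisGroup K) : γ ∈ galFixing K (embField K K) := by
  rw [mem_galFixing_iff]
  intro a ha
  obtain ⟨x, hx⟩ := (mem_embField_iff K K).mp ha
  have ha' : a = algebraMap K (AlgebraicClosure K) x := by
    apply (absClosureEmbedding K K).toRingHom.injective
    change absClosureEmbedding K K a = absClosureEmbedding K K (algebraMap K (AlgebraicClosure K) x)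
    rw [← hx, AlgHom.commutes]
  rw [ha', absoluteGaloisGroup.smul_def, AlgEquiv.commutes]

/-- **`liftGal k k` is the identity on `G_k^ab`.**  The tree's lift `liftGal K K : Gal(K̄/K₀) → Γ_K`
(inverse of the restriction `absGaloisRestrict K K` along the chosen embedding `K̄ → K̄`) is the inner
automorphism by a fixed `σ₀ ∈ Γ_K` (`exists_absGaloisRestrict_self_eq_conj`), hence induces the
identity on the topological abelianization. [cite: MochizukiAbsAnab2004, §1.2 p.9] -/
theorem absGaloisAbProj_liftGal_self {γ : absoluteGaloisGroup K} (hγ : γ ∈ galFixing K (embField K K)) :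
    absGaloisAbProj K (liftGal K K hγ) = absGaloisAbProj K γ := by
  obtain ⟨σ₀, hσ₀⟩ := exists_absGaloisRestrict_self_eq_conj (K := K)
  have h := absGaloisRestrict_liftGal K K hγ
  rw [hσ₀] at h
  -- `σ₀⁻¹ λ σ₀ = γ` with `λ := liftGal K K hγ`, so `λ = σ₀ γ σ₀⁻¹`
  have hl : liftGal K K hγ = σ₀⁻¹⁻¹ * γ * σ₀⁻¹ :=
    calc liftGal K K hγ = σ₀⁻¹⁻¹ * (σ₀⁻¹ * liftGal K K hγ * σ₀⁻¹⁻¹) * σ₀⁻¹ := by group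
      _ = σ₀⁻¹⁻¹ * γ * σ₀⁻¹ := by rw [h]
  rw [hl, map_mul, map_mul, mul_right_comm, ← map_mul, inv_inv, mul_inv_cancel, map_one, one_mul]

end SelfLevel

/-! ### The reciprocity square at level `k`: `θ_{k₂} (ψ̄♭ u) = α^{ab} (θ_{k₁} u)` -/

section Square

variable {K₁ K₂ : Type} [Field K₁] [ValuativeRel K₁] [TopologicalSpace K₁]
  [IsNonarchimedeanLocalField K₁] [CharZero K₁] [Field K₂] [ValuativeRel K₂] [TopologicalSpace K₂]
  [IsNonarchimedeanLocalField K₂] [CharZero K₂]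

omit [ValuativeRel K₁] [TopologicalSpace K₁] [IsNonarchimedeanLocalField K₁] [CharZero K₁] in
/-- `(equivEmbField K K u : K̄) = algebraMap K K̄ u`: at the trivial level the tree's `E ≃ E₀`
is the structure map (the chosen `K̄ ≃ₐ[K] K̄` fixes `K`). [cite: MochizukiAbsAnab2004, §1.2 p.9] -/
theorem coe_equivEmbField_self (u : K₁) :
    ((equivEmbField K₁ K₁ u : embField K₁ K₁) : AlgebraicClosure K₁) =
      algebraMap K₁ (AlgebraicClosure K₁) u := by
  change (absClosureEquiv K₁ K₁).symm (algebraMap K₁ (AlgebraicClosure K₁) u) = _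
  rw [AlgEquiv.commutes]

/-- **The reciprocity square at the base level** ([AbsAnab] Prop. 1.2.1 (iii) «`α^{ab}` preserves
`Im(K^×_i)`», read with THE units transport of (vi)): for `α : G_{k₁} ≃ₜ* G_{k₂}`, an `α`-equivariant
uniformiser-preserving `ψ̄ : k̄₁ˣ ⥲ k̄₂ˣ` and `u ∈ k₁ˣ`, the element `v ∈ k₂ˣ` with `ψ̄(u) = v` satisfies
`θ_{k₂}(v) = α^{ab}(θ_{k₁}(u))`, where `θ_k := (isReciprocitySystemE (isClassFieldTheory_localWeilDatum k)).theta`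
is the tree's canonical reciprocity map of `k` (Serre's `x ↦ (x, */k)` in Neukirch's Weil datum, at the
trivial level `E = k`; the binder `[ValuativeExtension kᵢ kᵢ]` is the trivial one `⟨fun _ _ => Iff.rfl⟩`).
Proof: abc-iut-L4-d3's `Prop121vii.levelwise_of_isAlphaEquivariant` at the level pair `(k₁, k₂)`
(`Art_{k₂} (ψ̄ u) = [α h]` whenever `Art_{k₁} u = [h]`, for the level packages characterised by Serre's
`θ`), `levelArt_eq_mk_iff_theta`, and `absGaloisAbProj_liftGal_self`.
[cite: MochizukiAbsAnab2004, Prop 1.2.1 (iii) p.10] -/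
theorem canonicalTheta_unitsTransport [ValuativeExtension K₁ K₁] [ValuativeExtension K₂ K₂]
    (α : absoluteGaloisGroup K₁ ≃ₜ* absoluteGaloisGroup K₂)
    {ψ : (AlgebraicClosure K₁)ˣ ≃* (AlgebraicClosure K₂)ˣ}
    (hψ : Prop121vii.IsAlphaEquivariant α ψ) (hU : Prop121vii.PreservesUniformizers ψ)
    (u : K₁ˣ) (v : K₂ˣ)
    (huv : ψ (Units.map (algebraMap K₁ (AlgebraicClosure K₁) : K₁ →* AlgebraicClosure K₁) u) =
      Units.map (algebraMap K₂ (AlgebraicClosure K₂) : K₂ →* AlgebraicClosure K₂) v) :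
    (isReciprocitySystemE (F := K₂) (E := K₂) (isClassFieldTheory_localWeilDatum K₂)).theta v =
      abelianizationCongr α
        ((isReciprocitySystemE (F := K₁) (E := K₁) (isClassFieldTheory_localWeilDatum K₁)).theta u) := by
  classical
  -- level packages at the trivial levels `(k₁, k₁)`, `(k₂, k₂)`
  obtain ⟨Art₁, θ₁, -, -, hchar₁, -⟩ := exists_levelReciprocity (F := K₁) (E := K₁)
  obtain ⟨Art₂, θ₂, -, -, hchar₂, -⟩ := exists_levelReciprocity (F := K₂) (E := K₂)
  -- `u` read in `k₁₀ˣ ⊆ k̄₁`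
  set u' : (embField K₁ K₁)ˣ := Units.map (equivEmbField K₁ K₁ : K₁ →* embField K₁ K₁) u with hu'
  set x : (AlgebraicClosure K₁)ˣ :=
    Units.map (algebraMap K₁ (AlgebraicClosure K₁) : K₁ →* AlgebraicClosure K₁) u with hx
  have hxu : (x : AlgebraicClosure K₁) = ((u' : embField K₁ K₁) : AlgebraicClosure K₁) := by
    rw [hx, hu', Units.coe_map, Units.coe_map, MonoidHom.coe_coe, MonoidHom.coe_coe,
      coe_equivEmbField_self]
  have hN : ∀ g : absoluteGaloisGroup K₁,
      g ∈ galFixing K₁ (embField K₁ K₁) ↔ α g ∈ galFixing K₂ (embField K₂ K₂) := fun g =>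
    ⟨fun _ => mem_galFixing_embField_self K₂ (α g), fun _ => mem_galFixing_embField_self K₁ g⟩
  obtain ⟨v', hψv, -, -, hArt⟩ :=
    Prop121vii.levelwise_of_isAlphaEquivariant α hψ hU K₁ K₂ hN u' x hxu
  -- `v' = v` read in `k₂`
  have hv' : Units.map ((equivEmbField K₂ K₂).symm : embField K₂ K₂ →* K₂) v' = v := by
    apply Units.ext
    apply (algebraMap K₂ (AlgebraicClosure K₂)).injective
    rw [← coe_equivEmbField_self (K₁ := K₂), Units.coe_map, MonoidHom.coe_coe, AlgEquiv.apply_symm_apply]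
    have h := congrArg (fun z : (AlgebraicClosure K₂)ˣ => (z : AlgebraicClosure K₂)) huv
    simp only [Units.coe_map, MonoidHom.coe_coe] at h
    rw [← h, ← hψv]
  have hu'' : Units.map ((equivEmbField K₁ K₁).symm : embField K₁ K₁ →* K₁) u' = u := by
    apply Units.ext
    rw [hu', Units.coe_map, Units.coe_map, MonoidHom.coe_coe, MonoidHom.coe_coe, AlgEquiv.symm_apply_apply]
  -- a representative `h` of `Art₁ u'`
  obtain ⟨h, hh⟩ := QuotientGroup.mk_surjective (Art₁ u')
  have hA₂ := hArt hchar₁ hchar₂ h hh.symm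
  -- read both sides through Serre's `θ`
  have e₁ := (levelArt_eq_mk_iff_theta hchar₁ u' h).mp hh.symm
  have e₂ := (levelArt_eq_mk_iff_theta hchar₂ v' ⟨α h, (hN h).mp h.2⟩).mp hA₂
  rw [hu''] at e₁
  rw [hv'] at e₂
  rw [← e₁, ← e₂, absGaloisAbProj_liftGal_self, absGaloisAbProj_liftGal_self]
  exact (abelianizationCongr_mk α (h : absoluteGaloisGroup K₁)).symm

/-! ### The square on the profinite completions: `e_{k₂} ∘ ψ̂ = α^{ab} ∘ e_{k₁}` -/

omit [ValuativeRel K₁] [TopologicalSpace K₁] [IsNonarchimedeanLocalField K₁] [CharZero K₁]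
  [ValuativeRel K₂] [TopologicalSpace K₂] [IsNonarchimedeanLocalField K₂] [CharZero K₂] in
/-- `α^{ab} : G_{k₁}^ab ≃* G_{k₂}^ab` (`abelianizationCongr α`) is continuous (it is `α` descended to the
quotients by the closed commutator subgroups). [cite: MochizukiAbsTopIII2015, Cor 1.10 (i) p.42] -/
theorem continuous_abelianizationCongr (α : absoluteGaloisGroup K₁ ≃ₜ* absoluteGaloisGroup K₂) :
    Continuous (abelianizationCongr α :
      absoluteGaloisGroupAbelianization K₁ → absoluteGaloisGroupAbelianization K₂) := by
  refine (QuotientGroup.isQuotientMap_mk _).continuous_iff.mpr ?_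
  exact QuotientGroup.continuous_mk.comp α.continuous

/-- **The reciprocity square on the profinite completions** ([AbsAnab] §1.2 p. 9 «`(K^×)^∧ ⥲ G^{ab}_K`»,
Prop. 1.2.1 (iii)): with `θ_{kᵢ}` the canonical reciprocity maps, `eᵢ : (kᵢˣ)^∧ ≃ₜ* G_{kᵢ}^ab` any
topological isomorphisms with `eᵢ ∘ η = θ_{kᵢ}` (`exists_completionEquiv_apply_eta_eq`), `f : k₁ˣ → k₂ˣ`
the restriction of the `α`-equivariant uniformiser-preserving `ψ̄` (`Prop121vii.IsAlphaEquivariant.exists_unitsMulEquiv`)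
and `Ψ : (k₁ˣ)^∧ → (k₂ˣ)^∧` any continuous homomorphism extending `f` (`Ψ ∘ η = η ∘ f`):
`e₂ (Ψ x) = α^{ab} (e₁ x)` for EVERY `x ∈ (k₁ˣ)^∧` — by `canonicalTheta_unitsTransport` on the dense
image of `η` and continuity. [cite: MochizukiAbsAnab2004, Prop 1.2.1 (iii) p.10] -/
theorem completionEquiv_unitsTransport [ValuativeExtension K₁ K₁] [ValuativeExtension K₂ K₂]
    (α : absoluteGaloisGroup K₁ ≃ₜ* absoluteGaloisGroup K₂)
    {ψ : (AlgebraicClosure K₁)ˣ ≃* (AlgebraicClosure K₂)ˣ}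
    (hψ : Prop121vii.IsAlphaEquivariant α ψ) (hU : Prop121vii.PreservesUniformizers ψ)
    {f : K₁ˣ →* K₂ˣ}
    (hf : ∀ u : K₁ˣ, Units.map (algebraMap K₂ (AlgebraicClosure K₂) : K₂ →* AlgebraicClosure K₂) (f u) =
      ψ (Units.map (algebraMap K₁ (AlgebraicClosure K₁) : K₁ →* AlgebraicClosure K₁) u))
    {Ψ : ProfiniteGrp.ProfiniteCompletion.completion (GrpCat.of K₁ˣ) →ₜ*
      ProfiniteGrp.ProfiniteCompletion.completion (GrpCat.of K₂ˣ)}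
    (hΨ : ∀ u : K₁ˣ, Ψ (ProfiniteGrp.ProfiniteCompletion.etaFn (GrpCat.of K₁ˣ) u) =
      ProfiniteGrp.ProfiniteCompletion.etaFn (GrpCat.of K₂ˣ) (f u))
    {e₁ : ProfiniteGrp.ProfiniteCompletion.completion (GrpCat.of K₁ˣ) ≃ₜ*
      absoluteGaloisGroupAbelianization K₁}
    (he₁ : ∀ u : K₁ˣ, e₁ (ProfiniteGrp.ProfiniteCompletion.etaFn (GrpCat.of K₁ˣ) u) =
      (isReciprocitySystemE (F := K₁) (E := K₁) (isClassFieldTheory_localWeilDatum K₁)).theta u)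
    {e₂ : ProfiniteGrp.ProfiniteCompletion.completion (GrpCat.of K₂ˣ) ≃ₜ*
      absoluteGaloisGroupAbelianization K₂}
    (he₂ : ∀ v : K₂ˣ, e₂ (ProfiniteGrp.ProfiniteCompletion.etaFn (GrpCat.of K₂ˣ) v) =
      (isReciprocitySystemE (F := K₂) (E := K₂) (isClassFieldTheory_localWeilDatum K₂)).theta v)
    (x : ProfiniteGrp.ProfiniteCompletion.completion (GrpCat.of K₁ˣ)) :
    e₂ (Ψ x) = abelianizationCongr α (e₁ x) := by
  haveI : T2Space (absoluteGaloisGroupAbelianization K₂) := by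
    haveI : IsClosed ((commutator (absoluteGaloisGroup K₂)).topologicalClosure :
        Set (absoluteGaloisGroup K₂)) := Subgroup.isClosed_topologicalClosure _
    infer_instance
  have key : (fun x => e₂ (Ψ x)) = fun x => abelianizationCongr α (e₁ x) := by
    refine (ProfiniteGrp.ProfiniteCompletion.denseRange (GrpCat.of K₁ˣ)).equalizer ?_ ?_ ?_
    · exact e₂.continuous.comp Ψ.continuous
    · exact (continuous_abelianizationCongr α).comp e₁.continuous
    · funext u
      change e₂ (Ψ (ProfiniteGrp.ProfiniteCompletion.etaFn (GrpCat.of K₁ˣ) u)) =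
        abelianizationCongr α (e₁ (ProfiniteGrp.ProfiniteCompletion.etaFn (GrpCat.of K₁ˣ) u))
      rw [hΨ, he₂, he₁]
      exact canonicalTheta_unitsTransport α hψ hU u (f u) (hf u).symm
  exact congrFun key x

end Square

end Cor110Nat

end Literature.AnabelianGeometry.AbsoluteAnabelian
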